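import Summits.Ventures.PercRepro.Night2ExcessLossM2

/-!
# PercRepro — the `(7, 5)` cell `(2, 0)` with `(m₂, m₁) = (3, 3)` (night-2, gen 20)

`Night2ExcessCellsD` closes `(2, 0)` when every non-basis thin member misses `≥ 4` points; `Night2SpreadCells`
when the basis members miss `≥ 4` and the non-basis ones `≥ 3`.  With the `m₂`-chord the pair `(m₂, m₁) = (3, 3)`
closes the cell at `10 ≤ n = |G| ≤ 14` (per-basis excess) and the crude `ρ λ₂ = 2/5` closes it at `n ≥ 15`
(`6 C(n, 6) ≤ A + 15 T`: `15 ≤ n ≤ 21` by kernel evaluation, `n ≥ 22` from `6 C(n, 6) ≤ C(n, 7) + C(n, 8)`).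
**`localShadowHall_two_zero_five_of_excess_m2`**: (LI_G) at the cell whenever every thin member — basis or not —
misses at least `3` points of `G`.
-/

namespace PercRepro.Shadow

open Finset PerFlat ThmH

namespace DGenP

/-- The chord of `1/(m + 2)` over `3 ≤ m ≤ 5` (cell `(2, 0)`, `n = 10`, `m₂ = 3`). -/
theorem chord_two_zero_10_m3 : ∀ m : ℕ, 3 ≤ m → m ≤ 5 →
    1 / ((m : ℚ) + ((2 : ℕ) : ℚ)) ≤ (2 / 7 : ℚ) - (1 / 35 : ℚ) * (m : ℚ) := by
  intro m h1 h2
  interval_cases m <;> norm_num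

/-- The `m₂ = 3` chord is nonnegative on `2 ≤ m ≤ 5`. -/
theorem chordpos_two_zero_10_m3 : ∀ m : ℕ, 2 ≤ m → m ≤ 5 → 0 ≤ (2 / 7 : ℚ) - (1 / 35 : ℚ) * (m : ℚ) := by
  intro m h1 h2
  interval_cases m <;> norm_num

/-- `excessBound = 8/15` at `(2, 0)`, `n = 10`, `m₂ = 3`. -/
theorem excessBound_two_zero_10_m3 : excessBound 5 2 6 0 10 (2 / 7 : ℚ) (1 / 35 : ℚ) = (8 / 15 : ℚ) := by
  unfold excessBound capDG phiQ; norm_num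

/-- The target sum of the cell `(2, 0)` at `n = 10` with `(m₂, m₁) = (3, 3)`: `A = 0`, `T = 176`. -/
theorem sum_two_zero_10_m3_m3 : 1 ≤ DGenP.genSum 10 6 4 (cPrimeDGP 5 2 6 0 3)
    (excessBound 5 2 6 0 10 (2 / 7 : ℚ) (1 / 35 : ℚ) / ((6 : ℕ) : ℚ)) := by
  have hc : cPrimeDGP 5 2 6 0 3 = (1 / 15 : ℚ) := by unfold cPrimeDGP capDG reqDGP phiQ; norm_num
  have hA : DGen.Aρt 10 6 4 = 0 := by decide
  have hT : DGen.Ttop 10 4 = 176 := by decide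
  have hC : Nat.choose 10 6 = 210 := by decide
  rw [excessBound_two_zero_10_m3, hc, DGenP.genSum_eq (by norm_num) (by norm_num) (by norm_num), hA, hT, hC]
  norm_num

/-- The chord of `1/(m + 2)` over `3 ≤ m ≤ 6` (cell `(2, 0)`, `n = 11`, `m₂ = 3`). -/
theorem chord_two_zero_11_m3 : ∀ m : ℕ, 3 ≤ m → m ≤ 6 →
    1 / ((m : ℚ) + ((2 : ℕ) : ℚ)) ≤ (11 / 40 : ℚ) - (1 / 40 : ℚ) * (m : ℚ) := by
  intro m h1 h2
  interval_cases m <;> norm_num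

/-- The `m₂ = 3` chord is nonnegative on `2 ≤ m ≤ 6`. -/
theorem chordpos_two_zero_11_m3 : ∀ m : ℕ, 2 ≤ m → m ≤ 6 → 0 ≤ (11 / 40 : ℚ) - (1 / 40 : ℚ) * (m : ℚ) := by
  intro m h1 h2
  interval_cases m <;> norm_num

/-- `excessBound = 11/24` at `(2, 0)`, `n = 11`, `m₂ = 3`. -/
theorem excessBound_two_zero_11_m3 : excessBound 5 2 6 0 11 (11 / 40 : ℚ) (1 / 40 : ℚ) = (11 / 24 : ℚ) := by
  unfold excessBound capDG phiQ; norm_num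

/-- The target sum of the cell `(2, 0)` at `n = 11` with `(m₂, m₁) = (3, 3)`: `A = 330`, `T = 232`. -/
theorem sum_two_zero_11_m3_m3 : 1 ≤ DGenP.genSum 11 6 4 (cPrimeDGP 5 2 6 0 3)
    (excessBound 5 2 6 0 11 (11 / 40 : ℚ) (1 / 40 : ℚ) / ((6 : ℕ) : ℚ)) := by
  have hc : cPrimeDGP 5 2 6 0 3 = (1 / 15 : ℚ) := by unfold cPrimeDGP capDG reqDGP phiQ; norm_num
  have hA : DGen.Aρt 11 6 4 = 330 := by decide
  have hT : DGen.Ttop 11 4 = 232 := by decide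
  have hC : Nat.choose 11 6 = 462 := by decide
  rw [excessBound_two_zero_11_m3, hc, DGenP.genSum_eq (by norm_num) (by norm_num) (by norm_num), hA, hT, hC]
  norm_num

/-- The chord of `1/(m + 2)` over `3 ≤ m ≤ 7` (cell `(2, 0)`, `n = 12`, `m₂ = 3`). -/
theorem chord_two_zero_12_m3 : ∀ m : ℕ, 3 ≤ m → m ≤ 7 →
    1 / ((m : ℚ) + ((2 : ℕ) : ℚ)) ≤ (4 / 15 : ℚ) - (1 / 45 : ℚ) * (m : ℚ) := by
  intro m h1 h2
  interval_cases m <;> norm_num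

/-- The `m₂ = 3` chord is nonnegative on `2 ≤ m ≤ 7`. -/
theorem chordpos_two_zero_12_m3 : ∀ m : ℕ, 2 ≤ m → m ≤ 7 → 0 ≤ (4 / 15 : ℚ) - (1 / 45 : ℚ) * (m : ℚ) := by
  intro m h1 h2
  interval_cases m <;> norm_num

/-- `excessBound = 2/5` at `(2, 0)`, `n = 12`, `m₂ = 3`. -/
theorem excessBound_two_zero_12_m3 : excessBound 5 2 6 0 12 (4 / 15 : ℚ) (1 / 45 : ℚ) = (2 / 5 : ℚ) := by
  unfold excessBound capDG phiQ; norm_num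

/-- The target sum of the cell `(2, 0)` at `n = 12` with `(m₂, m₁) = (3, 3)`: `A = 1287`, `T = 299`. -/
theorem sum_two_zero_12_m3_m3 : 1 ≤ DGenP.genSum 12 6 4 (cPrimeDGP 5 2 6 0 3)
    (excessBound 5 2 6 0 12 (4 / 15 : ℚ) (1 / 45 : ℚ) / ((6 : ℕ) : ℚ)) := by
  have hc : cPrimeDGP 5 2 6 0 3 = (1 / 15 : ℚ) := by unfold cPrimeDGP capDG reqDGP phiQ; norm_num
  have hA : DGen.Aρt 12 6 4 = 1287 := by decide
  have hT : DGen.Ttop 12 4 = 299 := by decide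
  have hC : Nat.choose 12 6 = 924 := by decide
  rw [excessBound_two_zero_12_m3, hc, DGenP.genSum_eq (by norm_num) (by norm_num) (by norm_num), hA, hT, hC]
  norm_num

/-- The chord of `1/(m + 2)` over `3 ≤ m ≤ 8` (cell `(2, 0)`, `n = 13`, `m₂ = 3`). -/
theorem chord_two_zero_13_m3 : ∀ m : ℕ, 3 ≤ m → m ≤ 8 →
    1 / ((m : ℚ) + ((2 : ℕ) : ℚ)) ≤ (13 / 50 : ℚ) - (1 / 50 : ℚ) * (m : ℚ) := by
  intro m h1 h2
  interval_cases m <;> norm_num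

/-- The `m₂ = 3` chord is nonnegative on `2 ≤ m ≤ 8`. -/
theorem chordpos_two_zero_13_m3 : ∀ m : ℕ, 2 ≤ m → m ≤ 8 → 0 ≤ (13 / 50 : ℚ) - (1 / 50 : ℚ) * (m : ℚ) := by
  intro m h1 h2
  interval_cases m <;> norm_num

/-- `excessBound = 53/150` at `(2, 0)`, `n = 13`, `m₂ = 3`. -/
theorem excessBound_two_zero_13_m3 : excessBound 5 2 6 0 13 (13 / 50 : ℚ) (1 / 50 : ℚ) = (53 / 150 : ℚ) := by
  unfold excessBound capDG phiQ; norm_num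

/-- The target sum of the cell `(2, 0)` at `n = 13` with `(m₂, m₁) = (3, 3)`: `A = 3718`, `T = 378`. -/
theorem sum_two_zero_13_m3_m3 : 1 ≤ DGenP.genSum 13 6 4 (cPrimeDGP 5 2 6 0 3)
    (excessBound 5 2 6 0 13 (13 / 50 : ℚ) (1 / 50 : ℚ) / ((6 : ℕ) : ℚ)) := by
  have hc : cPrimeDGP 5 2 6 0 3 = (1 / 15 : ℚ) := by unfold cPrimeDGP capDG reqDGP phiQ; norm_num
  have hA : DGen.Aρt 13 6 4 = 3718 := by decide
  have hT : DGen.Ttop 13 4 = 378 := by decide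
  have hC : Nat.choose 13 6 = 1716 := by decide
  rw [excessBound_two_zero_13_m3, hc, DGenP.genSum_eq (by norm_num) (by norm_num) (by norm_num), hA, hT, hC]
  norm_num

/-- The chord of `1/(m + 2)` over `3 ≤ m ≤ 9` (cell `(2, 0)`, `n = 14`, `m₂ = 3`). -/
theorem chord_two_zero_14_m3 : ∀ m : ℕ, 3 ≤ m → m ≤ 9 →
    1 / ((m : ℚ) + ((2 : ℕ) : ℚ)) ≤ (14 / 55 : ℚ) - (1 / 55 : ℚ) * (m : ℚ) := by
  intro m h1 h2
  interval_cases m <;> norm_num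

/-- The `m₂ = 3` chord is nonnegative on `2 ≤ m ≤ 9`. -/
theorem chordpos_two_zero_14_m3 : ∀ m : ℕ, 2 ≤ m → m ≤ 9 → 0 ≤ (14 / 55 : ℚ) - (1 / 55 : ℚ) * (m : ℚ) := by
  intro m h1 h2
  interval_cases m <;> norm_num

/-- `excessBound = 52/165` at `(2, 0)`, `n = 14`, `m₂ = 3`. -/
theorem excessBound_two_zero_14_m3 : excessBound 5 2 6 0 14 (14 / 55 : ℚ) (1 / 55 : ℚ) = (52 / 165 : ℚ) := by
  unfold excessBound capDG phiQ; norm_num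

/-- The target sum of the cell `(2, 0)` at `n = 14` with `(m₂, m₁) = (3, 3)`: `A = 9438`, `T = 470`. -/
theorem sum_two_zero_14_m3_m3 : 1 ≤ DGenP.genSum 14 6 4 (cPrimeDGP 5 2 6 0 3)
    (excessBound 5 2 6 0 14 (14 / 55 : ℚ) (1 / 55 : ℚ) / ((6 : ℕ) : ℚ)) := by
  have hc : cPrimeDGP 5 2 6 0 3 = (1 / 15 : ℚ) := by unfold cPrimeDGP capDG reqDGP phiQ; norm_num
  have hA : DGen.Aρt 14 6 4 = 9438 := by decide
  have hT : DGen.Ttop 14 4 = 470 := by decide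
  have hC : Nat.choose 14 6 = 3003 := by decide
  rw [excessBound_two_zero_14_m3, hc, DGenP.genSum_eq (by norm_num) (by norm_num) (by norm_num), hA, hT, hC]
  norm_num

/-- `c′ = 1/15` at `(q, d, ρ, k, m₁) = (5, 2, 6, 0, 3)`. -/
theorem cPrimeDGP_two_zero_m3 : cPrimeDGP 5 2 6 0 3 = 1 / 15 := by
  unfold cPrimeDGP capDG reqDGP phiQ; norm_num

/-- `λ₂ = 1/15` at `(q, d, ρ, k, m₂) = (5, 2, 6, 0, 3)`. -/
theorem lambdaDGS_two_zero_m3 : lambdaDGS 5 2 6 0 3 = 1 / 15 := by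
  unfold lambdaDGS reqDGP capDG phiQ; norm_num

/-- `C(n, 7) + C(n, 8) ≥ 6 C(n, 6)` for `n ≥ 22`. -/
theorem two_zero_growth_m33 {n : ℕ} (hn : 22 ≤ n) : 6 * n.choose 6 ≤ n.choose 7 + n.choose 8 := by
  obtain ⟨m, rfl⟩ : ∃ m, n = m + 22 := ⟨n - 22, by omega⟩
  have h7 := Nat.choose_succ_right_eq (m + 22) 6
  have h8 := Nat.choose_succ_right_eq (m + 22) 7
  rw [show m + 22 - 6 = m + 16 by omega] at h7
  rw [show m + 22 - 7 = m + 15 by omega] at h8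
  have l7 : 16 * (m + 22).choose 6 ≤ 7 * (m + 22).choose 7 := by
    nlinarith [h7, Nat.zero_le ((m + 22).choose 6 * m)]
  have l8 : 15 * (m + 22).choose 7 ≤ 8 * (m + 22).choose 8 := by
    nlinarith [h8, Nat.zero_le ((m + 22).choose 7 * m)]
  omega

/-- The bounded range `15 ≤ n ≤ 21` of the `(2, 0)` inequality with `(m₂, m₁) = (3, 3)`. -/
theorem two_zero_ineq_m33_small {n : ℕ} (hn : 15 ≤ n) (hn' : n ≤ 21) :
    6 * n.choose 6 ≤ DGen.Aρt n 6 4 + 15 * DGen.Ttop n 4 := by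
  have hid : (∑ i ∈ Finset.range 7, n.choose i) + DGen.Aρt n 6 4 + DGen.Ttop n 4 = 2 ^ n :=
    DGen.sum_range_add_Aρt_add_Ttop (by omega)
  have key : 6 * n.choose 6 + (∑ i ∈ Finset.range 7, n.choose i) ≤ 2 ^ n + 14 * DGen.Ttop n 4 := by
    unfold DGen.Ttop
    interval_cases n <;> decide
  omega

/-- **The `(2, 0)` inequality with `(m₂, m₁) = (3, 3)`** `6 C(n, 6) ≤ A + 15 T` for every `n ≥ 15`. -/
theorem two_zero_ineq_m33 {n : ℕ} (hn : 15 ≤ n) : 6 * n.choose 6 ≤ DGen.Aρt n 6 4 + 15 * DGen.Ttop n 4 := by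
  by_cases h : n ≤ 21
  · exact two_zero_ineq_m33_small hn h
  · push Not at h
    have hA : n.choose 7 + n.choose 8 ≤ DGen.Aρt n 6 4 := DGen.Aρt_ge_two (by omega)
    have h2 := two_zero_growth_m33 (by omega : 22 ≤ n)
    omega

/-- The crude target sum of the cell `(2, 0)` with `(m₂, m₁) = (3, 3)` is at least `1` for every `n ≥ 15`. -/
theorem one_le_genSum_two_zero_m33 {n : ℕ} (hn : 15 ≤ n) :
    1 ≤ genSum n 6 4 (cPrimeDGP 5 2 6 0 3) (lambdaDGS 5 2 6 0 3) := by
  rw [cPrimeDGP_two_zero_m3, lambdaDGS_two_zero_m3, genSum_eq (by omega) (by norm_num) (by norm_num)]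
  have hC : (0 : ℚ) < (n.choose 6 : ℚ) := by exact_mod_cast Nat.choose_pos (by omega)
  rw [le_div_iff₀ (by positivity)]
  have key' : (6 : ℚ) * (n.choose 6 : ℚ) ≤ (DGen.Aρt n 6 4 : ℚ) + 15 * (DGen.Ttop n 4 : ℚ) := by
    exact_mod_cast two_zero_ineq_m33 hn
  norm_num
  linarith

end DGenP

variable {α : Type*} [DecidableEq α] {M : Matroid α} [M.Finite]

open DGenP in
open scoped Classical in
/-- **THE `(7, 5)` CELL `(2, 0)` WITH `(m₂, m₁) = (3, 3)`**: every thin member misses at least `3` points of `G`. -/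
theorem localShadowHall_two_zero_five_of_excess_m2 {G : Finset α} (hG : G ∈ flatsQ M (5 + 1))
    (hd : (gr M \ G).card = 2) (hk : kColoops M G = 0)
    (hs : ∀ e ∈ gr M, ∀ f ∈ gr M, e ≠ f → rkN M {e, f} = 2) (hl : ∀ e ∈ gr M, M.Indep {e})
    (hm₁ : ∀ B ∈ thinMembers M 5 G, 6 ≤ (B \ coloops M G).card → 3 ≤ (G \ clF M B).card)
    (hm₂ : ∀ B ∈ thinMembers M 5 G, (B \ coloops M G).card + 1 = 6 → 3 ≤ (G \ clF M B).card) :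
    LocalShadowHall M 5 G := by
  have hk' : kColoops M G + 6 = 5 + 1 := by omega
  have hc3 : 0 ≤ cPrimeDGP 5 2 6 (kColoops M G) 3 := by rw [hk]; unfold cPrimeDGP capDG reqDGP phiQ; norm_num
  by_cases hn10 : 10 ≤ G.card - kColoops M G
  · by_cases hn14 : G.card - kColoops M G ≤ 14
    · obtain ⟨n, hn⟩ : ∃ n, G.card - kColoops M G = n := ⟨_, rfl⟩
      have hn1' : 10 ≤ n := by omega
      have hn2' : n ≤ 14 := by omega
      interval_cases n
      · exact localShadowHall_excess_of_sum_m2 (d := 2) (ρ := 6) (m₁ := 3) (m₂ := 3) hG hd (by norm_num) hk'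
          (by norm_num) (by omega) hs hl hc3 hm₁ hm₂ (a := (2 / 7 : ℚ)) (b := (1 / 35 : ℚ)) (by norm_num)
          (by rw [hn]; intro m h1 h2; exact chord_two_zero_10_m3 m h1 (by omega))
          (by rw [hn]; intro m h1 h2; exact chordpos_two_zero_10_m3 m h1 (by omega))
          (by rw [hn, hk, excessBound_two_zero_10_m3]; norm_num) (by rw [hn, hk]; exact sum_two_zero_10_m3_m3)
      · exact localShadowHall_excess_of_sum_m2 (d := 2) (ρ := 6) (m₁ := 3) (m₂ := 3) hG hd (by norm_num) hk'
          (by norm_num) (by omega) hs hl hc3 hm₁ hm₂ (a := (11 / 40 : ℚ)) (b := (1 / 40 : ℚ)) (by norm_num)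
          (by rw [hn]; intro m h1 h2; exact chord_two_zero_11_m3 m h1 (by omega))
          (by rw [hn]; intro m h1 h2; exact chordpos_two_zero_11_m3 m h1 (by omega))
          (by rw [hn, hk, excessBound_two_zero_11_m3]; norm_num) (by rw [hn, hk]; exact sum_two_zero_11_m3_m3)
      · exact localShadowHall_excess_of_sum_m2 (d := 2) (ρ := 6) (m₁ := 3) (m₂ := 3) hG hd (by norm_num) hk'
          (by norm_num) (by omega) hs hl hc3 hm₁ hm₂ (a := (4 / 15 : ℚ)) (b := (1 / 45 : ℚ)) (by norm_num)
          (by rw [hn]; intro m h1 h2; exact chord_two_zero_12_m3 m h1 (by omega))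
          (by rw [hn]; intro m h1 h2; exact chordpos_two_zero_12_m3 m h1 (by omega))
          (by rw [hn, hk, excessBound_two_zero_12_m3]; norm_num) (by rw [hn, hk]; exact sum_two_zero_12_m3_m3)
      · exact localShadowHall_excess_of_sum_m2 (d := 2) (ρ := 6) (m₁ := 3) (m₂ := 3) hG hd (by norm_num) hk'
          (by norm_num) (by omega) hs hl hc3 hm₁ hm₂ (a := (13 / 50 : ℚ)) (b := (1 / 50 : ℚ)) (by norm_num)
          (by rw [hn]; intro m h1 h2; exact chord_two_zero_13_m3 m h1 (by omega))
          (by rw [hn]; intro m h1 h2; exact chordpos_two_zero_13_m3 m h1 (by omega))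
          (by rw [hn, hk, excessBound_two_zero_13_m3]; norm_num) (by rw [hn, hk]; exact sum_two_zero_13_m3_m3)
      · exact localShadowHall_excess_of_sum_m2 (d := 2) (ρ := 6) (m₁ := 3) (m₂ := 3) hG hd (by norm_num) hk'
          (by norm_num) (by omega) hs hl hc3 hm₁ hm₂ (a := (14 / 55 : ℚ)) (b := (1 / 55 : ℚ)) (by norm_num)
          (by rw [hn]; intro m h1 h2; exact chord_two_zero_14_m3 m h1 (by omega))
          (by rw [hn]; intro m h1 h2; exact chordpos_two_zero_14_m3 m h1 (by omega))
          (by rw [hn, hk, excessBound_two_zero_14_m3]; norm_num) (by rw [hn, hk]; exact sum_two_zero_14_m3_m3)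
    · push Not at hn14
      exact localShadowHall_dgenS_of_sum (d := 2) (ρ := 6) (m₁ := 3) (m₂ := 3) hG hd (by norm_num) hk'
        (by norm_num) (by omega) hs hl hc3 (by rw [hk, DGenP.lambdaDGS_two_zero_m3]; norm_num) hm₁ hm₂
        (by rw [hk] at hn14 ⊢; exact DGenP.one_le_genSum_two_zero_m33 (by omega))
  · -- fewer than 10 points off the coloops: there is no thin member at all
    exact localShadowHall_of_spread (ρ := 6) (m₀ := 5) hG hd (by norm_num) (by rw [hk])
      (fun B hB => absurd (thin_card_bound (ρ := 6) hG hd (by norm_num) (by rw [hk]) hB) (by omega))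
      (by rw [hk]; unfold phiQ; norm_num)

end PercRepro.Shadow
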